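import Summits.QuantumFields.YangMills.Theorems.BalabanUVNodesN15BackgroundPropagator
import Summits.QuantumFields.YangMills.Theorems.BalabanUVNodesN15DerivDefectLattices
import Literature.MathematicalPhysics.QuantumFieldTheory.Balaban1983to89.B9Eq3130MatrixLetters
import HarnessLib

/-!
# THE GLUING STEP AT TWO LATTICE SPACINGS, I: the glued inverse `G = G₀(1 − R)⁻¹` of a parametrix pair `(G₀, R)` — inverse identities and its block majorant with
# the smallness of `R` CONSUMED (the `M ≥ M₁` guard of [B9] Thm 3.1 live at the root of the expansion) (dag-n15-c g11, FILE 43; N15 = NE2, s1 «background-layer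
# OPERATOR ingredient»)

Cell `pub-ymgap`, seat `pub-ymgap-dag-n15-c` (R134 (a); HUMAN RULING D-0062), generation 11.  `bears_on: R4∕N15 · K3⁷ SpineGivenEndpointR13SepCoPH (stmt-QuantumFields-20544)`.
Filed `--supports stmt-QuantumFields-20544 --as helper` — COUNT-NEUTRAL.  Two plumbing `def`s (`neumannR`, `glueInv`), the rest theorems; 0 `sorry`.  Imports BY NAME n15-b A1
`…N15BackgroundPropagator` (`isUnit_one_sub_toMatrix'`), `…N15DerivDefectLattices` (`exists_const_hasMaj_ofBlocks`), lit `B9Eq3130MatrixLetters.hasMaj_id_ofBlocks`, `B11SectG` (`HasMaj`,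
`hasMaj_comp_exp`, `neumann_majorant`), `T4EtaRateDefect`∕`T4EtaRateCoeffDefect`, `B6Prop26.fixedPoint_of_291`; nothing in the tree is modified.

WHY (the printed architecture, [Balaban1985BackgroundPropagators] p. 399, verbatim): *«we will prove the above theorems by constructing generalized random walk expansions. Terms of
these expansions are built of the above defined propagators localized to subdomains, e.g. to cubes … We have to prove the theorems for the localized propagators. This is accomplished
by using the regularity conditions (3.35) and expanding with respect to A = (1∕iη)log U^u. This way the theorems are reduced to the corresponding theorems for propagators without external
gauge field.»*  The CUBE step (perturbation around `U ≡ 1` in ONE gauge) is this lineage's g0–g10 chain — honest on a cube in its (3.35) gauge, MODEL-LEVEL on the whole torus — and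
dag-n15-w3's curved∕gauge-covariance files; the GLUING of cube-localized propagators into the global one is [Balaban1984PropagatorsII] Sect. 2's parametrix, p. 239 (2.91) *«G₀ =
Σ_{□∈𝒟} h_□G_□h_□ … Δ_aG₀ = I − R»*, p. 247 *«|(RJ)(x)| ≤ O(M^{−1})e^{−½δ₂d(y,y′)}|J| (2.135) … Reasoning in the same way as in the proof of Proposition 2.2 we obtain Proposition 2.6»*
— in the tree at ONE spacing (`B6Prop26.fixedPoint_of_291`, `B6Prop26Gluing`, `B6RandomWalk.majorant_of_fixedPoint_266`), at NO spacing pair (the spine's NE2 is a TWO-spacing statement,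
`T4EtaRate`∕`T4EtaRateDefect`).  THIS FILE resums the parametrix pair abstractly and majorizes the glued inverse; FILE 44 `…N15TwoSpacingGluingDefect` is its η-DEFECT (the two-spacing
content); the companion `…N15TwoSpacingGluingCubes` supplies `(G₀, R)` from cube-localized propagators and a partition `Σ_□ h_□² = 1` with their letters.

WHAT (a finite lattice `X` with blocks `blk` over a [B6] block geometry `g`; sharp-block sup sizes).  §1 `neumannR R := (1 − R)⁻¹` (matrix inverse): `one_sub_comp_neumannR` ∕
`neumannR_comp_one_sub` (two-sided under the unit hypothesis), `neumannR_fix(_right)` (`N = 1 + RN = 1 + NR`), `isUnit_neumannR` (the unit FROM the smallness `θ·c_r < 1` of `R ≤ θe^{−δd}`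
— A1's sup-norm contraction: where [B6]'s «O(M⁻¹) … M sufficiently large» is consumed), ★ `hasMaj_neumannR` (`N ≤ (1 − θc_r)⁻¹e^{−ρd}`, `ρ + σ ≤ δ`: lit `neumann_majorant` from the source
`1`), `inv_one_sub_le_two_of_M` (the `M`-LIVE reading `θ = κ₀∕M`, `M ≥ 2κ₀c_r` ⟹ `(1 − θc_r)⁻¹ ≤ 2`).  §2 `glueInv G₀ R := G₀ ∘ N` ([B6]'s `G = G₀(I − R)⁻¹`): ★ `lap_comp_glueInv` ((2.91)
`Δ_aG₀ = 1 − R` ⟹ `Δ_a G = 1`), `glueInv_comp_lap` (finite dimension: also a left inverse), `eq_glueInv_of_comp_lap` (ANY left inverse of `Δ_a` IS the glued operator), `glueInv_fix` (the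
printed fixed point `G = G₀ + GR` — `B6Prop26.fixedPoint_of_291` BY NAME), `glueInv_fix'` (the same from `N = 1 + NR` alone).  §3 ★★ `hasMaj_glueInv` (`G ≤ A(1 − θc_r)⁻¹c_r·e^{−(δ−σ)d}`
from `G₀ ≤ Ae^{−δd}`, `R ≤ θe^{−δd}`, `θc_r < 1`), `hasMaj_glueInv_of_M` (`R ≤ (κ₀∕M)e^{−δd}`, `M ≥ 2κ₀c_r` ⟹ `G ≤ 2Ac_r·e^{−(δ−σ)d}` — the `M ≥ M₁` guard of [B9] Thm 3.1 ∕
`T4EtaRate.NE2PlusOperator` doing WORK at the root, cf. ref-F FLAG-VACUITY-A1 on the lineage's `M ≡ 1` families).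

HONEST FRAMING ∕ LIMITS.  Finite-dimensional operator algebra + block-majorant bookkeeping over DISPLAYED parametrix letters ([B6] (2.91) p. 239, (2.134)–(2.136) p. 247 and [B9] p. 399
are MECHANISM; nothing of [B6]∕[B9] is asserted).  The letters of `(G₀, R)` are HYPOTHESES here; the companion derives them from CUBE-LOCALIZED propagators + a partition of unity,
whose own letters (the lineage's perturbative device on Dirichlet cubes in the cube's (3.35) gauge; [B4] §5 — no tree producer) stay located.  NE2⁺ NOT PRINTED, NOT proved; N15 NOT
discharged; counts of record UNMOVED (typed 28∕28 · discharged 5∕27); one finite 𝕋⁴ at fixed ε — NOT infinite volume, NOT OS on ℝ⁴, NOT a mass gap, NOT Clay; R4 closes the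
conditional finite-𝕋⁴ rung `BalabanLadder.UV` only.  Restate-immune (no Theses import).
-/



noncomputable section

namespace Summit.QuantumFields.YangMills.BalabanUVNodes.N15.Gluing

open Literature.MathematicalPhysics.QuantumFieldTheory.Balaban1983to89
open Literature.MathematicalPhysics.QuantumFieldTheory.Balaban1983to89.B11SectG (BlockNorm HasMaj RowSum hasMaj_comp_exp neumann_majorant)
open Literature.MathematicalPhysics.QuantumFieldTheory.Balaban1983to89.B6RandomWalk (Triangle254)
open Literature.MathematicalPhysics.QuantumFieldTheory.Balaban1983to89.B6Prop26 (fixedPoint_of_291)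
open Literature.MathematicalPhysics.QuantumFieldTheory.Balaban1983to89.B9Eq3130MatrixLetters (hasMaj_id_ofBlocks)
open Summit.QuantumFields.YangMills.BalabanUVNodes.N15.BackgroundLayer (isUnit_one_sub_toMatrix')
open Summit.QuantumFields.YangMills.BalabanUVNodes.N15.DerivDefect (exists_const_hasMaj_ofBlocks)

/-! ## §1 The resummation `N = (1 − R)⁻¹`: inverse identities, the unit from smallness, the majorant -/

section Neumann

variable {X : Type} [Fintype X] [DecidableEq X]

/-- THE RESUMMATION OPERATOR `N = (1 − R)⁻¹` of a (small) remainder `R`, as a linear map through the matrix inverse — the sum `Σ_n Rⁿ` of [B6]'s generalized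
random walk expansion when it converges. [cite: Balaban1984PropagatorsII, (2.91) p.239 + p.247 («Reasoning in the same way as in the proof of Proposition 2.2»: shape)] -/
def neumannR (R : (X → ℝ) →ₗ[ℝ] (X → ℝ)) : (X → ℝ) →ₗ[ℝ] (X → ℝ) :=
  Matrix.toLin' (1 - LinearMap.toMatrix' R)⁻¹

/-- The matrix of `N` is the inverse matrix of `1 − [R]`. [folklore] -/
theorem toMatrix'_neumannR (R : (X → ℝ) →ₗ[ℝ] (X → ℝ)) : LinearMap.toMatrix' (neumannR R) = (1 - LinearMap.toMatrix' R)⁻¹ :=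
  LinearMap.toMatrix'_toLin' _

/-- The matrix of `1 − R`. [folklore] -/
theorem toMatrix'_id_sub (R : (X → ℝ) →ₗ[ℝ] (X → ℝ)) : LinearMap.toMatrix' (LinearMap.id - R) = 1 - LinearMap.toMatrix' R := by
  rw [map_sub, LinearMap.toMatrix'_id]

/-- `(1 − R)∘N = 1` under the unit hypothesis. [folklore] -/
theorem one_sub_comp_neumannR {R : (X → ℝ) →ₗ[ℝ] (X → ℝ)} (hunit : IsUnit (1 - LinearMap.toMatrix' R)) :
    (LinearMap.id - R) ∘ₗ neumannR R = LinearMap.id := by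
  apply LinearMap.toMatrix'.injective
  rw [LinearMap.toMatrix'_comp, toMatrix'_id_sub, toMatrix'_neumannR, LinearMap.toMatrix'_id,
    Matrix.mul_nonsing_inv _ ((Matrix.isUnit_iff_isUnit_det _).1 hunit)]

/-- `N∘(1 − R) = 1` under the unit hypothesis. [folklore] -/
theorem neumannR_comp_one_sub {R : (X → ℝ) →ₗ[ℝ] (X → ℝ)} (hunit : IsUnit (1 - LinearMap.toMatrix' R)) :
    neumannR R ∘ₗ (LinearMap.id - R) = LinearMap.id := by
  apply LinearMap.toMatrix'.injective
  rw [LinearMap.toMatrix'_comp, toMatrix'_id_sub, toMatrix'_neumannR, LinearMap.toMatrix'_id,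
    Matrix.nonsing_inv_mul _ ((Matrix.isUnit_iff_isUnit_det _).1 hunit)]

/-- THE LEFT FIXED POINT `N = 1 + R∘N` (the Neumann ∕ random-walk form). [cite: Balaban1985Variational, (188) p.308 (shape)] -/
theorem neumannR_fix {R : (X → ℝ) →ₗ[ℝ] (X → ℝ)} (hunit : IsUnit (1 - LinearMap.toMatrix' R)) :
    neumannR R = LinearMap.id + R ∘ₗ neumannR R := by
  have h := one_sub_comp_neumannR hunit
  rw [LinearMap.sub_comp, LinearMap.id_comp, sub_eq_iff_eq_add] at h
  exact h

/-- THE RIGHT FIXED POINT `N = 1 + N∘R`. [folklore] -/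
theorem neumannR_fix_right {R : (X → ℝ) →ₗ[ℝ] (X → ℝ)} (hunit : IsUnit (1 - LinearMap.toMatrix' R)) :
    neumannR R = LinearMap.id + neumannR R ∘ₗ R := by
  have h := neumannR_comp_one_sub hunit
  rw [LinearMap.comp_sub, LinearMap.comp_id, sub_eq_iff_eq_add] at h
  exact h

variable {g : B6.Geometry} (blk : X → g.Site) {σ cr : ℝ}

/-- Row sums of a decaying majorant: `Σ_{y′} θe^{−δd(y,y′)} ≤ θ·c_r` for `σ ≤ δ`, `θ ≥ 0`. [cite: Balaban1984PropagatorsII, Lemma 2.1 (2.61) p.234] -/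
theorem rowSum_exp_le (hd : ∀ a b : g.Site, 0 ≤ g.dist a b) (hrow : RowSum g σ cr) {θ δ : ℝ} (hθ : 0 ≤ θ) (hσδ : σ ≤ δ) (y : g.Site) :
    ∑ y', θ * Real.exp (-(δ * g.dist y y')) ≤ θ * cr := by
  rw [← Finset.mul_sum]
  exact mul_le_mul_of_nonneg_left ((hrow.mono hd hσδ) y) hθ

/-- **`1 − [R]` IS A UNIT FROM THE SMALLNESS OF `R`**: `R ≤ θe^{−δd}` with `θ·c_r < 1` (n15-b A1's sup-norm contraction). This is where [B6]'s «O(M⁻¹) … for M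
sufficiently large» is consumed. [cite: Balaban1984PropagatorsII, (2.135) p.247 (mechanism)] -/
theorem isUnit_neumannR (hd : ∀ a b : g.Site, 0 ≤ g.dist a b) (hrow : RowSum g σ cr) {R : (X → ℝ) →ₗ[ℝ] (X → ℝ)} {θ δ : ℝ} (hθ : 0 ≤ θ) (hσδ : σ ≤ δ)
    (hR : HasMaj (BlockNorm.ofBlocks g blk) (BlockNorm.ofBlocks g blk) R (fun y y' => θ * Real.exp (-(δ * g.dist y y')))) (hq : θ * cr < 1) :
    IsUnit (1 - LinearMap.toMatrix' R) :=
  isUnit_one_sub_toMatrix' hR (fun _ _ => mul_nonneg hθ (Real.exp_nonneg _)) (rowSum_exp_le hd hrow hθ hσδ) hq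

/-- ★ **THE MAJORANT OF THE RESUMMATION**: `N = (1 − R)⁻¹ ≤ (1 − θc_r)⁻¹·e^{−ρd}` for `ρ ≥ 0`, `ρ + σ ≤ δ` — lit `B11SectG.neumann_majorant` run from the source `1`
(`hasMaj_id_ofBlocks`, `d(y,y) = 0`) with the a priori bound of the finite lattice. [cite: Balaban1984PropagatorsII, (2.52)–(2.56) pp.232–233, Lemma 2.1 p.234 (mechanism)] -/
theorem hasMaj_neumannR (htri : Triangle254 g) (hd : ∀ a b : g.Site, 0 ≤ g.dist a b) (hd0 : ∀ y : g.Site, g.dist y y = 0) (hrow : RowSum g σ cr)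
    {R : (X → ℝ) →ₗ[ℝ] (X → ℝ)} {θ δ ρ : ℝ} (hθ : 0 ≤ θ) (hρ : 0 ≤ ρ) (hρδ : ρ + σ ≤ δ)
    (hR : HasMaj (BlockNorm.ofBlocks g blk) (BlockNorm.ofBlocks g blk) R (fun y y' => θ * Real.exp (-(δ * g.dist y y')))) (hq : θ * cr < 1) :
    HasMaj (BlockNorm.ofBlocks g blk) (BlockNorm.ofBlocks g blk) (neumannR R) (fun y y' => (1 - θ * cr)⁻¹ * Real.exp (-(ρ * g.dist y y'))) := by
  have hσδ : σ ≤ δ := by linarith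
  have hunit := isUnit_neumannR blk hd hrow hθ hσδ hR hq
  obtain ⟨M₀, hM₀, hap⟩ := exists_const_hasMaj_ofBlocks (g := g) blk blk (neumannR R)
  have hS := hasMaj_id_ofBlocks (g := g) blk hd0 ρ
  have hκ : (BlockNorm.ofBlocks g blk).κ = 1 := rfl
  have hq' : (BlockNorm.ofBlocks g blk).κ * θ * cr < 1 := by rw [hκ, one_mul]; exact hq
  have key := neumann_majorant (b₁ := BlockNorm.ofBlocks g blk) (b₂ := BlockNorm.ofBlocks g blk) (K' := R) (S := LinearMap.id) (A0 := neumannR R)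
    htri hd hrow hθ zero_le_one hM₀ hρ hρδ hR hS (neumannR_fix hunit) hap hq'
  refine key.mono fun a b => le_of_eq ?_
  simp only [hκ, one_mul]

/-- THE `M`-LIVE READING OF THE SMALLNESS: with [B6]'s `θ = κ₀∕M` ((2.134)–(2.135): «O(M⁻¹)») and `M ≥ 2κ₀c_r > 0`, the Neumann constant is at most `2`. [cite: Balaban1984PropagatorsII, (2.135) p.247] -/
theorem inv_one_sub_le_two_of_M {κ₀ M : ℝ} (hM : 0 < M) (hMge : 2 * κ₀ * cr ≤ M) :
    κ₀ / M * cr < 1 ∧ (1 - κ₀ / M * cr)⁻¹ ≤ 2 := by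
  have h1 : κ₀ / M * cr ≤ 1 / 2 := by
    rw [div_mul_eq_mul_div, div_le_iff₀ hM]
    linarith
  refine ⟨by linarith, ?_⟩
  have h2 : (1 : ℝ) / 2 ≤ 1 - κ₀ / M * cr := by linarith
  calc (1 - κ₀ / M * cr)⁻¹ ≤ (1 / 2 : ℝ)⁻¹ := inv_anti₀ (by norm_num) h2
    _ = 2 := by norm_num

end Neumann

/-! ## §2 The glued inverse `G = G₀ ∘ (1 − R)⁻¹` of a parametrix pair: inverse identities, uniqueness, the printed fixed point -/

section Glue

variable {X : Type} [Fintype X] [DecidableEq X]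

/-- **THE GLUED INVERSE** `G := G₀ ∘ (1 − R)⁻¹` of a parametrix pair `(G₀, R)` — [B6]'s `G = G₀(I − R)⁻¹ = Σ_ω G₀(ω)` (the generalized random walk
expansion resummed). [cite: Balaban1984PropagatorsII, (2.91) p.239 + p.247 (shape)] -/
def glueInv (G₀ R : (X → ℝ) →ₗ[ℝ] (X → ℝ)) : (X → ℝ) →ₗ[ℝ] (X → ℝ) := G₀ ∘ₗ neumannR R

/-- Unfolding. [folklore] -/
theorem glueInv_def (G₀ R : (X → ℝ) →ₗ[ℝ] (X → ℝ)) : glueInv G₀ R = G₀ ∘ₗ neumannR R := rfl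

/-- ★ **THE PARAMETRIX IDENTITY RESUMMED**: `Δ_aG₀ = 1 − R` (2.91) and `1 − [R]` a unit ⟹ `Δ_a ∘ G = 1`. [cite: Balaban1984PropagatorsII, (2.91) p.239] -/
theorem lap_comp_glueInv {Δa G₀ R : (X → ℝ) →ₗ[ℝ] (X → ℝ)} (hunit : IsUnit (1 - LinearMap.toMatrix' R)) (h291 : Δa ∘ₗ G₀ = LinearMap.id - R) :
    Δa ∘ₗ glueInv G₀ R = LinearMap.id := by
  rw [glueInv, ← LinearMap.comp_assoc, h291, one_sub_comp_neumannR hunit]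

/-- Finite dimension: the glued operator is also a LEFT inverse of `Δ_a` (`mul_eq_one_comm`). [folklore] -/
theorem glueInv_comp_lap {Δa G₀ R : (X → ℝ) →ₗ[ℝ] (X → ℝ)} (hunit : IsUnit (1 - LinearMap.toMatrix' R)) (h291 : Δa ∘ₗ G₀ = LinearMap.id - R) :
    glueInv G₀ R ∘ₗ Δa = LinearMap.id := by
  have h := congrArg LinearMap.toMatrix' (lap_comp_glueInv hunit h291)
  rw [LinearMap.toMatrix'_comp, LinearMap.toMatrix'_id, mul_eq_one_comm] at h
  apply LinearMap.toMatrix'.injective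
  rw [LinearMap.toMatrix'_comp, LinearMap.toMatrix'_id, h]

/-- UNIQUENESS: any left inverse `G` of `Δ_a` IS the glued operator (`G = G∘Δ_a∘G_glue = G_glue`). [folklore] -/
theorem eq_glueInv_of_comp_lap {Δa G₀ R G : (X → ℝ) →ₗ[ℝ] (X → ℝ)} (hunit : IsUnit (1 - LinearMap.toMatrix' R)) (h291 : Δa ∘ₗ G₀ = LinearMap.id - R)
    (hinv : G ∘ₗ Δa = LinearMap.id) : G = glueInv G₀ R := by
  calc G = G ∘ₗ (Δa ∘ₗ glueInv G₀ R) := by rw [lap_comp_glueInv hunit h291, LinearMap.comp_id]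
    _ = (G ∘ₗ Δa) ∘ₗ glueInv G₀ R := by rw [LinearMap.comp_assoc]
    _ = glueInv G₀ R := by rw [hinv, LinearMap.id_comp]

/-- THE PRINTED FIXED POINT `G = G₀ + G∘R` of the glued inverse — `B6Prop26.fixedPoint_of_291` BY NAME. [cite: Balaban1984PropagatorsII, (2.91) p.239] -/
theorem glueInv_fix {Δa G₀ R : (X → ℝ) →ₗ[ℝ] (X → ℝ)} (hunit : IsUnit (1 - LinearMap.toMatrix' R)) (h291 : Δa ∘ₗ G₀ = LinearMap.id - R) :
    glueInv G₀ R = G₀ + glueInv G₀ R ∘ₗ R :=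
  fixedPoint_of_291 (G := glueInv G₀ R) (G0 := G₀) (R := R) (Δa := Δa) (glueInv_comp_lap hunit h291) h291

/-- The same fixed point WITHOUT reference to `Δ_a` (from `N = 1 + NR` alone). [folklore] -/
theorem glueInv_fix' {G₀ R : (X → ℝ) →ₗ[ℝ] (X → ℝ)} (hunit : IsUnit (1 - LinearMap.toMatrix' R)) :
    glueInv G₀ R = G₀ + glueInv G₀ R ∘ₗ R := by
  unfold glueInv
  conv_lhs => rw [neumannR_fix_right hunit]
  rw [LinearMap.comp_add, LinearMap.comp_id, LinearMap.comp_assoc]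

end Glue

/-! ## §3 The majorant of the glued inverse — the smallness of `R` consumed -/

section Majorant

variable {X : Type} [Fintype X] [DecidableEq X] {g : B6.Geometry} (blk : X → g.Site) {σ cr : ℝ}

/-- ★★ **THE GLUED INVERSE DECAYS**: `G₀ ≤ Ae^{−δd}`, `R ≤ θe^{−δd}`, `θc_r < 1`, `2σ ≤ δ` ⟹ `G ≤ A(1 − θc_r)⁻¹c_r·e^{−(δ−σ)d}` — [B6] Prop. 2.6's first entry
(2.136) for the glued operator, constants explicit. [cite: Balaban1984PropagatorsII, Prop. 2.6 (2.136) p.247 (shape + mechanism)] -/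
theorem hasMaj_glueInv (htri : Triangle254 g) (hd : ∀ a b : g.Site, 0 ≤ g.dist a b) (hd0 : ∀ y : g.Site, g.dist y y = 0) (hrow : RowSum g σ cr) (hσ : 0 ≤ σ)
    {G₀ R : (X → ℝ) →ₗ[ℝ] (X → ℝ)} {A θ δ : ℝ} (hA : 0 ≤ A) (hθ : 0 ≤ θ) (hσδ : 2 * σ ≤ δ)
    (hG₀ : HasMaj (BlockNorm.ofBlocks g blk) (BlockNorm.ofBlocks g blk) G₀ (fun y y' => A * Real.exp (-(δ * g.dist y y'))))
    (hR : HasMaj (BlockNorm.ofBlocks g blk) (BlockNorm.ofBlocks g blk) R (fun y y' => θ * Real.exp (-(δ * g.dist y y')))) (hq : θ * cr < 1) :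
    HasMaj (BlockNorm.ofBlocks g blk) (BlockNorm.ofBlocks g blk) (glueInv G₀ R)
      (fun y y' => A * (1 - θ * cr)⁻¹ * cr * Real.exp (-((δ - σ) * g.dist y y'))) := by
  have hN := hasMaj_neumannR blk htri hd hd0 hrow (ρ := δ - σ) hθ (by linarith) (by linarith) hR hq
  have hinv0 : 0 ≤ (1 - θ * cr)⁻¹ := inv_nonneg.2 (by linarith)
  have key := hasMaj_comp_exp (b₁ := BlockNorm.ofBlocks g blk) (b₂ := BlockNorm.ofBlocks g blk) (b₃ := BlockNorm.ofBlocks g blk) (T₁ := G₀) (T₂ := neumannR R)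
    (ρ := δ - σ) htri hd hrow hA hinv0 (by linarith) le_rfl (by linarith) hG₀ hN
  refine key.mono fun a b => le_of_eq ?_
  rw [show (BlockNorm.ofBlocks g blk).κ = 1 from rfl]
  ring

/-- **THE `M`-LIVE EDITION**: `R ≤ (κ₀∕M)e^{−δd}` ((2.135)'s «O(M⁻¹)») and `M ≥ 2κ₀c_r`, `M > 0` ⟹ `G ≤ 2Ac_r·e^{−(δ−σ)d}` — the `M ≥ M₁` guard of [B9] Thm 3.1
(`T4EtaRate.NE2PlusOperator`'s `M₅ ≤ gf.M`) doing work at the root of the expansion. [cite: Balaban1984PropagatorsII, (2.135)–(2.136) p.247; Balaban1985BackgroundPropagators, Thm 3.1 p.397 (the guard `M ≥ M₁`)] -/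
theorem hasMaj_glueInv_of_M (htri : Triangle254 g) (hd : ∀ a b : g.Site, 0 ≤ g.dist a b) (hd0 : ∀ y : g.Site, g.dist y y = 0) (hrow : RowSum g σ cr) (hσ : 0 ≤ σ)
    (hcr : 0 ≤ cr) {G₀ R : (X → ℝ) →ₗ[ℝ] (X → ℝ)} {A κ₀ M δ : ℝ} (hA : 0 ≤ A) (hκ₀ : 0 ≤ κ₀) (hM : 0 < M) (hMge : 2 * κ₀ * cr ≤ M) (hσδ : 2 * σ ≤ δ)
    (hG₀ : HasMaj (BlockNorm.ofBlocks g blk) (BlockNorm.ofBlocks g blk) G₀ (fun y y' => A * Real.exp (-(δ * g.dist y y'))))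
    (hR : HasMaj (BlockNorm.ofBlocks g blk) (BlockNorm.ofBlocks g blk) R (fun y y' => κ₀ / M * Real.exp (-(δ * g.dist y y')))) :
    HasMaj (BlockNorm.ofBlocks g blk) (BlockNorm.ofBlocks g blk) (glueInv G₀ R) (fun y y' => 2 * A * cr * Real.exp (-((δ - σ) * g.dist y y'))) := by
  obtain ⟨hq, h2⟩ := inv_one_sub_le_two_of_M (cr := cr) (κ₀ := κ₀) hM hMge
  refine (hasMaj_glueInv blk htri hd hd0 hrow hσ hA (div_nonneg hκ₀ hM.le) hσδ hG₀ hR hq).mono fun a b => ?_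
  have hE : 0 ≤ Real.exp (-((δ - σ) * g.dist a b)) := Real.exp_nonneg _
  have : A * (1 - κ₀ / M * cr)⁻¹ * cr ≤ 2 * A * cr := by
    calc A * (1 - κ₀ / M * cr)⁻¹ * cr ≤ A * 2 * cr := by gcongr
      _ = 2 * A * cr := by ring
  exact mul_le_mul_of_nonneg_right this hE

end Majorant

end Summit.QuantumFields.YangMills.BalabanUVNodes.N15.Gluing

end
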